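import Summits.Ventures.QEC.Census.CSSNormalFormSAT.EncodeSoundCore
import HarnessLib

/-!
# Cube trees cover every assignment (KERNEL-PLAN item 4/5 plumbing for the split instances)

The large normal-form instances are refuted leaf by leaf: a binary CUBE TREE splits on one DIMACS variable `v` per internal node into the
unit literals `v` / `-v` (census/type-02/css161/sat2/cubes/*/tree.json); each leaf's accumulated unit list `us` has its own kernel theorem
`Sat.Fmla.proof ((NFEnc.cnf c ++ us.map ([·])).map …) Sat.Clause.nil`. This file: the tree datatype, its leaves with accumulated units, and
the COVER LEMMA — for every Boolean assignment `β` some leaf has all its unit literals true (`exists_leaf_allTrue`), so `false_of_unsat_units`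
(EncodeSoundSym.lean) applies to that leaf. [folklore]
-/

set_option autoImplicit false

namespace Summit.Ventures.QEC.Census.CSSNormalFormSAT

/-- A binary cube tree: leaves carry an id; an internal node splits on the (positive) DIMACS variable `v`. (definition) -/
inductive CubeTree where
  | leaf : ℕ → CubeTree
  | node : ℕ → CubeTree → CubeTree → CubeTree

namespace CubeTree

/-- The leaves below `t` with their accumulated unit literals (prefix `acc`, most recent last): the positive child of `node v` adds `v`,
the negative child `-v`. (definition) -/
def leaves : CubeTree → List ℤ → List (ℕ × List ℤ)
  | leaf k, acc => [(k, acc)]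
  | node v p n, acc => leaves p (acc ++ [(v : ℤ)]) ++ leaves n (acc ++ [-(v : ℤ)])

/-- All split variables are `≥ 1`. (definition) -/
def WellFormed : CubeTree → Prop
  | leaf _ => True
  | node v p n => 1 ≤ v ∧ WellFormed p ∧ WellFormed n

/-- **Cover lemma**: if all literals of `acc` are true under `β`, some leaf below has all its unit literals true. [folklore] -/
theorem exists_leaf_allTrue (β : ℕ → Bool) :
    ∀ (t : CubeTree) (acc : List ℤ), WellFormed t → (∀ l ∈ acc, litVal β l = true) →
      ∃ kl ∈ leaves t acc, ∀ l ∈ kl.2, litVal β l = true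
  | leaf k, acc, _, hacc => ⟨(k, acc), by simp [leaves], hacc⟩
  | node v p n, acc, hwf, hacc => by
    obtain ⟨hv, hp, hn⟩ := hwf
    cases hβ : β v
    · -- go to the negative child
      obtain ⟨kl, hkl, hall⟩ := exists_leaf_allTrue β n (acc ++ [-(v : ℤ)]) hn (by
        intro l hl
        rcases List.mem_append.1 hl with hl | hl
        · exact hacc l hl
        · simp only [List.mem_singleton] at hl
          subst hl
          have h1 : (-(v : ℤ)) < 0 := by omega
          have h2 : (-(-(v : ℤ))).toNat = v := by omega
          simp only [litVal, h1, if_true, h2, hβ]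
          rfl)
      exact ⟨kl, by simp [leaves, hkl], hall⟩
    · obtain ⟨kl, hkl, hall⟩ := exists_leaf_allTrue β p (acc ++ [(v : ℤ)]) hp (by
        intro l hl
        rcases List.mem_append.1 hl with hl | hl
        · exact hacc l hl
        · simp only [List.mem_singleton] at hl
          subst hl
          have h1 : ¬ (v : ℤ) < 0 := by omega
          have h2 : ((v : ℤ)).toNat = v := by omega
          simp only [litVal, h1, if_false, h2, hβ])
      exact ⟨kl, by simp [leaves, hkl], hall⟩

/-- Unit literals accumulated in a well-formed tree are nonzero. [folklore] -/
theorem ne_zero_of_mem_leaves : ∀ (t : CubeTree) (acc : List ℤ), WellFormed t → (∀ l ∈ acc, l ≠ 0) →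
    ∀ kl ∈ leaves t acc, ∀ l ∈ kl.2, l ≠ 0
  | leaf k, acc, _, hacc, kl, hkl, l, hl => by
    simp only [leaves, List.mem_singleton] at hkl; subst hkl; exact hacc l hl
  | node v p n, acc, hwf, hacc, kl, hkl, l, hl => by
    obtain ⟨hv, hp, hn⟩ := hwf
    simp only [leaves, List.mem_append] at hkl
    rcases hkl with hkl | hkl
    · refine ne_zero_of_mem_leaves p _ hp ?_ kl hkl l hl
      intro l' hl'
      rcases List.mem_append.1 hl' with h | h
      · exact hacc l' h
      · simp at h; omega
    · refine ne_zero_of_mem_leaves n _ hn ?_ kl hkl l hl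
      intro l' hl'
      rcases List.mem_append.1 hl' with h | h
      · exact hacc l' h
      · simp at h; omega

end CubeTree

end Summit.Ventures.QEC.Census.CSSNormalFormSAT
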